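import Mathlib
import Summits.ABC.ABC.Statement
import Summits.ABC.ABC.Theorems.SoloBlindFermatCorner
import Summits.ABC.ABC.Theorems.SoloBlindMersenneCorner
import HarnessLib

/-!
# Congruences on the Nagell–Ljunggren residues of shapes C and D (solo-blind seat, session 5)

The two Nagell–Ljunggren residues of the ω = 3 atlas carry the primitive-divisor congruence, made kernel here:

* `shapeC_residue_congruence` : `2^k p^m + 1 = q^ℓ` (`p, q, ℓ` odd primes, `m ≥ 1`) ⇒ `2ℓ ∣ p - 1`
  (the order of `q` modulo `p` is exactly `ℓ`, since `p ∤ q - 1` by `fermat_prime_corner`).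
* `shapeD_residue_congruence` : `p^ℓ + 1 = 2^k q^n` (`p, q, ℓ` odd primes, `n ≥ 1`) ⇒ `2ℓ ∣ q - 1`
  (the order of `-p` modulo `q` is exactly `ℓ`, since `q ∤ p + 1` by `mersenne_prime_corner`).

So the shape-C residue reads `(q^ℓ - 1)/(q - 1) = p^m` with `q = 2^s + 1`, `p ≡ 1 (mod 2ℓ)`, and the shape-D residue reads
`(p^ℓ + 1)/(p + 1) = q^n` with `p = 2^s - 1`, `q ≡ 1 (mod 2ℓ)`.
-/

namespace Summit.ABC.ABC.Theorems

/-- If `x : ZMod p` (`p` prime) has `x ^ ℓ = 1`, `x ≠ 1`, `ℓ` prime, then `ℓ ∣ p - 1`. -/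
private theorem prime_dvd_card_sub_one_of_pow_eq_one {p ℓ : ℕ} (hp : p.Prime) (hℓ : ℓ.Prime) {x : ZMod p}
    (hx : x ^ ℓ = 1) (hx1 : x ≠ 1) : ℓ ∣ p - 1 := by
  haveI := Fact.mk hp
  haveI := Fact.mk hℓ
  have hord : orderOf x = ℓ := orderOf_eq_prime hx hx1
  have hx0 : x ≠ 0 := by
    rintro rfl
    rw [zero_pow hℓ.ne_zero] at hx
    exact zero_ne_one hx
  rw [← hord]
  exact ZMod.orderOf_dvd_card_sub_one hx0

/-- **Shape C residue congruence.** If `p, q, ℓ` are odd primes, `m ≥ 1` and `2^k p^m + 1 = q^ℓ`, then `2ℓ ∣ p - 1`. -/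
theorem shapeC_residue_congruence {k m ℓ p q : ℕ} (hp : p.Prime) (hq : q.Prime) (hℓ : ℓ.Prime) (hp2 : p ≠ 2)
    (hq2 : q ≠ 2) (hℓ2 : ℓ ≠ 2) (hm : 1 ≤ m) (h : 2 ^ k * p ^ m + 1 = q ^ ℓ) : 2 * ℓ ∣ p - 1 := by
  have hnot := (fermat_prime_corner hp hq hℓ hp2 hq2 hℓ2 h).1
  have hq1 : 1 ≤ q ^ ℓ := Nat.one_le_pow _ _ hq.pos
  have hpd : p ∣ q ^ ℓ - 1 := by
    have : q ^ ℓ - 1 = 2 ^ k * p ^ m := by omega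
    rw [this]
    exact (dvd_pow_self p (by omega)).mul_left _
  have hx : ((q : ZMod p)) ^ ℓ = 1 := by
    have h0 : ((q ^ ℓ - 1 : ℕ) : ZMod p) = 0 := by rwa [ZMod.natCast_eq_zero_iff]
    rwa [Nat.cast_sub hq1, Nat.cast_pow, Nat.cast_one, sub_eq_zero] at h0
  have hx1 : (q : ZMod p) ≠ 1 := by
    intro h1
    apply hnot
    have : ((q - 1 : ℕ) : ZMod p) = 0 := by rw [Nat.cast_sub hq.one_le, Nat.cast_one, h1, sub_self]
    rwa [ZMod.natCast_eq_zero_iff] at this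
  have hℓd : ℓ ∣ p - 1 := prime_dvd_card_sub_one_of_pow_eq_one hp hℓ hx hx1
  have h2d : 2 ∣ p - 1 := by
    have := Nat.odd_iff.mp (hp.odd_of_ne_two hp2)
    omega
  exact Nat.Coprime.mul_dvd_of_dvd_of_dvd ((Nat.coprime_primes Nat.prime_two hℓ).mpr (Ne.symm hℓ2)) h2d hℓd

/-- **Shape D residue congruence.** If `p, q, ℓ` are odd primes, `n ≥ 1` and `p^ℓ + 1 = 2^k q^n`, then `2ℓ ∣ q - 1`. -/
theorem shapeD_residue_congruence {k n ℓ p q : ℕ} (hp : p.Prime) (hq : q.Prime) (hℓ : ℓ.Prime) (hp2 : p ≠ 2)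
    (hq2 : q ≠ 2) (hℓ2 : ℓ ≠ 2) (hn : 1 ≤ n) (h : p ^ ℓ + 1 = 2 ^ k * q ^ n) : 2 * ℓ ∣ q - 1 := by
  have hnot := (mersenne_prime_corner hp hq hℓ hp2 hq2 hℓ2 h).1
  have hqd : q ∣ p ^ ℓ + 1 := by
    rw [h]
    exact (dvd_pow_self q (by omega)).mul_left _
  -- `x = -p` in `ZMod q` has `x^ℓ = 1` (ℓ odd) and `x ≠ 1`
  have hℓodd : Odd ℓ := hℓ.odd_of_ne_two hℓ2
  have hx : (-(p : ZMod q)) ^ ℓ = 1 := by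
    have h0 : ((p ^ ℓ + 1 : ℕ) : ZMod q) = 0 := by rwa [ZMod.natCast_eq_zero_iff]
    rw [Nat.cast_add, Nat.cast_pow, Nat.cast_one] at h0
    rw [hℓodd.neg_pow]
    linear_combination -h0
  have hx1 : (-(p : ZMod q)) ≠ 1 := by
    intro h1
    apply hnot
    have : ((p + 1 : ℕ) : ZMod q) = 0 := by
      rw [Nat.cast_add, Nat.cast_one]
      linear_combination -h1
    rwa [ZMod.natCast_eq_zero_iff] at this
  have hℓd : ℓ ∣ q - 1 := prime_dvd_card_sub_one_of_pow_eq_one hq hℓ hx hx1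
  have h2d : 2 ∣ q - 1 := by
    have := Nat.odd_iff.mp (hq.odd_of_ne_two hq2)
    omega
  exact Nat.Coprime.mul_dvd_of_dvd_of_dvd ((Nat.coprime_primes Nat.prime_two hℓ).mpr (Ne.symm hℓ2)) h2d hℓd

end Summit.ABC.ABC.Theorems
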